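import Mathlib
import HarnessLib
import Summits.AtomisticToContinuum.FouriersLaw.Theses.JunctionLocality
import Summits.AtomisticToContinuum.FouriersLaw.Theorems.JunctionLocalitySuperadditiveResistanceStubTerminationLocalityAux5
import Summits.AtomisticToContinuum.FouriersLaw.Theorems.JunctionLocalitySuperadditiveResistanceStubTerminationLocalityTC
import Summits.AtomisticToContinuum.FouriersLaw.Theorems.JunctionLocalitySuperadditiveResistanceKuboPlain

/-!
# Termination locality in the κ-frame, helper IX: `N`-UNIFORM dissipation budgets at the γ-bathed end
(stub `stub_terminationLocality` (S1') of line `floating-probe-bypass-laplacian`, skeleton v7, crux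
`JunctionLocality.SuperadditiveResistance`, stmt-AtomisticToContinuum-11748)

The `N`-uniform content of S1' is a bound on end-site functionals of the bare chain's plain forward field `g_N` and of
the device's `κ`-resolvent field `g_0` (helpers V–VIII). This file lands the a priori `N`-UNIFORM estimates on them that
the exact dissipation identities yield once the Cauchy–Schwarz lower bound at the SOURCE site `p_0` is subtracted
(`‖∂_{p_0} g‖² ≥ ⟨g, p_0² − T⟩²/T³`: Gaussian integration by parts `Kubo.gauss_ibp` and `‖p_0‖² = T`):

* `plainField_endGradient_sq_le` — for every classical forward field of the bare `N`-chain (`N ≥ 1`, `β > 0`):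
  `‖∂_{p_{N−1}} g_N‖²_{L²(μ_T^{(N)})} ≤ (T/γ⁴) G_N (γ − G_N)` (`G_N = plainKubo … g_N`; carré du champ
  `plainField_dirichlet` of `…StubTerminationLocalityTC`);
* `plainField_fluctGradient_sq_le` — its part orthogonal to `p_{N−1}`:
  `‖∂_{p_{N−1}} g_N − (G_N/γ²)p_{N−1}‖² ≤ (T/γ⁴) G_N (γ − 2 G_N)` (Pythagoras + the far-end sum rule
  `plainField_endPairing`); hence
* `plainKubo_le_half` — `G_N ≤ γ/2` for `N ≥ 2` (two contact resistances `1/γ` in series; sharpens `plainKubo_le`);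
* `resolvent_dissipation`, `resolventFamily_farDissipation_le` — for the bath-`0` member of a resolvent family of the
  `(N, M)`-device (`N, M ≥ 1`, any `κ`): `κ‖g_0‖² + γT Σ_b ‖∂_{p_{s_b}} g_0‖² = ⟨g_0, p_0² − T⟩` over the four
  terminals, and `κ‖g_0‖² + γT(‖∂_{p_{N−1}}g_0‖² + ‖∂_{p_N}g_0‖² + ‖∂_{p_{N+M−1}}g_0‖²) ≤ (T²/γ³) K₀₀ (γ − K₀₀)`;
* `helper_terminationEndGradientBudget` (registered) — the four budgets bundled, for resolvent families and plain forward
  fields (`N, M ≥ 2`).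

So, UNIFORMLY IN `N, M, κ`: the whole end gradient of the bare field driving `Dyn_N` is `O(√G_N)` in `L²` (fluctuating
part `r_N` included — `…StubTerminationLocalityTC` had only `O(1)` for `r_N`), and the device field's entropy production
at the probe `N−1`, at the three far terminals together, and its `κ`-mass are `O(K₀₀)`. These do not by themselves close
the fluctuation bound of helper VIII: heuristically, after integrating `Dyn_N^{fl}` by parts in `p_{N−1}`, they control
its `∂_{p_{N−1}}(g_0∘R)`-piece at size `O(√(G_N K₀₀))` only — one factor `√(G_N K₀₀)` short of `O(G_N K₀₀)` — and say
nothing about the piece carrying the undifferentiated `g_0∘R`. Standard axioms, no named fact used.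
-/

noncomputable section

open MeasureTheory Filter Topology
open scoped ContDiff
open Literature.MathematicalPhysics.KineticTheory.HeatConduction
open Summit.AtomisticToContinuum.FouriersLaw.Theorems.SuperadditiveResistance.DeviceLiouville
  (kin deviceGenerator deviceWeight deviceGenerator_eq kin_eq_sq liouvilleOp bathOp generator_eq_liouvilleOp_add)
open Summit.AtomisticToContinuum.FouriersLaw.Theorems.SuperadditiveResistance.Kubo
  (memLp_partialP memLp_kinetic memLp_momentum gauss_ibp fluctuation_dissipation partition_pos
    integrable_mul_mul_gibbsDensity)
open Summit.AtomisticToContinuum.FouriersLaw.Cruxes.SuperadditiveResistance.ThermaliseThenCutProbeInsertion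
  (plainField_dirichlet plainField_endPairing plainField_projection integral_sub_proj_sq integral_sq_momentum
    sum_bathWeight_mul)

namespace Summit.AtomisticToContinuum.FouriersLaw.Cruxes.SuperadditiveResistance.FloatingProbeBypassLaplacian

/-! ## `N`-UNIFORM dissipation budgets at the γ-bathed end (exact identities ⇒ a priori bounds) -/

section Budget

variable {ω₂ lam β γ T : ℝ} {N M : ℕ}

/-- The left bath site `0` of the bare `N`-chain carries a positive bath weight. -/
theorem bathWeight_zero_pos (hN : 1 ≤ N) : 0 < OscillatorChain.bathWeight N ⟨0, by omega⟩ := by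
  unfold OscillatorChain.bathWeight; simp only; split_ifs <;> norm_num

/-- `∂_{p_0} g_N ∈ L²(μ_T^{(N)})` for a classical forward field of the bare `N`-chain. -/
theorem memLp_partialP_zero_plainField (hω : 0 < ω₂) (hl : 0 ≤ lam) (hβ : 0 ≤ β) (hγ : 0 < γ) (hN : 1 ≤ N)
    (hT : 0 < T) {gN : PhaseSpace N → ℝ} (hgC : ContDiff ℝ 2 gN)
    (hgL2 : MemLp gN 2 ((pinnedChain ω₂ lam β γ).gibbsMeasure N T))
    (hgpde : ∀ y, (pinnedChain ω₂ lam β γ).generator N T T gN y = -(kin N 0 y - T)) :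
    MemLp (partialP ⟨0, by omega⟩ gN) 2 ((pinnedChain ω₂ lam β γ).gibbsMeasure N T) := by
  have hpair : ∀ y, 1 * liouvilleOp (pinnedChain ω₂ lam β γ) N gN y +
      γ * bathOp N (OscillatorChain.bathWeight N) T gN y = -(kin N 0 y - T) := by
    intro y
    rw [← hgpde y, generator_eq_liouvilleOp_add]
    have : (pinnedChain ω₂ lam β γ).γ = γ := rfl
    rw [this, one_mul]
  have hk : MemLp (fun y : PhaseSpace N => kin N 0 y - T) 2 ((pinnedChain ω₂ lam β γ).gibbsMeasure N T) :=
    memLp_kin_sub hω hl hβ γ N 0 hT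
  have hB : ∀ i : Fin N, 0 ≤ OscillatorChain.bathWeight N i := fun i => by
    unfold OscillatorChain.bathWeight; split_ifs <;> norm_num
  exact memLp_partialP hω hl hβ γ N hT _ hB 1 hγ hgC hgL2 hk hpair (bathWeight_zero_pos hN)

/-- **The source-site gradient is large (Cauchy–Schwarz).** For a plain forward field `g_N` of the bare
`N`-chain: `‖∂_{p_0} g_N‖² ≥ ⟨g_N, p_0² − T⟩² / T³` (`⟨p_0, ∂_{p_0} g_N⟩ = ⟨g_N, p_0² − T⟩/T` by Gaussian
integration by parts, and `‖p_0‖² = T`). -/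
theorem plainField_sourceGradient_sq_ge (hω : 0 < ω₂) (hl : 0 ≤ lam) (hβ : 0 ≤ β) (hγ : 0 < γ) (hN : 1 ≤ N)
    (hT : 0 < T) {gN : PhaseSpace N → ℝ} (hgC : ContDiff ℝ 2 gN)
    (hgL2 : MemLp gN 2 ((pinnedChain ω₂ lam β γ).gibbsMeasure N T))
    (hgpde : ∀ y, (pinnedChain ω₂ lam β γ).generator N T T gN y = -(kin N 0 y - T)) :
    (∫ y, gN y * (kin N 0 y - T) ∂((pinnedChain ω₂ lam β γ).gibbsMeasure N T)) ^ 2 / T ^ 3 ≤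
      ∫ y, partialP ⟨0, by omega⟩ gN y ^ 2 ∂((pinnedChain ω₂ lam β γ).gibbsMeasure N T) := by
  set P := pinnedChain ω₂ lam β γ with hP
  set μ := P.gibbsMeasure N T with hμ
  have hd0 := memLp_partialP_zero_plainField hω hl hβ hγ hN hT hgC hgL2 hgpde
  -- Gaussian integration by parts in `p_0`
  have hproj : ∫ y, y.2 ⟨0, by omega⟩ * partialP ⟨0, by omega⟩ gN y ∂μ = 1 / T * ∫ y, gN y * (kin N 0 y - T) ∂μ := by
    have h := gauss_ibp hω hl hβ N hT ⟨0, by omega⟩ (hgC.of_le (by norm_cast)) hgL2 hd0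
    rw [hμ, P.integral_gibbsMeasure, P.integral_gibbsMeasure]
    have e1 : ∫ x, gN x * (kin N 0 x - T) * P.gibbsDensity N T x =
        ∫ x, (x.2 ⟨0, by omega⟩ ^ 2 - T) * gN x * P.gibbsDensity N T x :=
      integral_congr_ae (ae_of_all _ fun x => by dsimp only; rw [kin_eq_sq (show 0 < N by omega)]; ring)
    rw [e1, h]
    have hP' : pinnedChain ω₂ lam β γ = P := rfl
    simp only [hP']
    field_simp
  -- Pythagoras for the projection onto `p_0`
  set A := ∫ y, partialP ⟨0, by omega⟩ gN y ^ 2 ∂μ with hA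
  set P0 := ∫ y, gN y * (kin N 0 y - T) ∂μ with hP0
  have hpy := integral_sub_proj_sq (γ := γ) hω hl hβ hT ⟨0, by omega⟩ hd0 (P0 / T ^ 2)
  rw [← hμ, hproj, ← hA] at hpy
  have hnn : 0 ≤ ∫ y, (partialP ⟨0, by omega⟩ gN y - P0 / T ^ 2 * y.2 ⟨0, by omega⟩) ^ 2 ∂μ :=
    integral_nonneg fun y => sq_nonneg _
  rw [hpy] at hnn
  have hT0 : T ≠ 0 := hT.ne'
  have e : A - 2 * (P0 / T ^ 2) * (1 / T * P0) + (P0 / T ^ 2) ^ 2 * T = A - P0 ^ 2 / T ^ 3 := by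
    field_simp; ring
  rw [e] at hnn
  linarith

/-- **`N`-UNIFORM END-GRADIENT BUDGET OF THE BARE FIELD.** For the pinned chain (`ω₂ > 0`, `lam ≥ 0`, `β > 0`,
`γ, T > 0`, `N ≥ 1`) and any classical forward field `g_N ∈ C² ∩ L²(μ_T^{(N)})` of the bare `N`-chain's left bath,
with `G_N = plainKubo … g_N`:

  `‖∂_{p_{N−1}} g_N‖²_{L²(μ_T^{(N)})} ≤ (T/γ⁴) · G_N · (γ − G_N)`.

(Carré du champ `γT(‖∂_{p_0}g_N‖² + ‖∂_{p_{N−1}}g_N‖²) = ⟨g_N, p_0² − T⟩ = (T²/γ²)(γ − G_N)` minus the Cauchy–Schwarz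
lower bound `‖∂_{p_0} g_N‖² ≥ (T/γ⁴)(γ − G_N)²` at the SOURCE site.) So the whole end gradient driving `Dyn_N` is
`O(√G_N)` in `L²`, uniformly in `N` — not merely `O(1)`. -/
theorem plainField_endGradient_sq_le (hω : 0 < ω₂) (hl : 0 ≤ lam) (hβ : 0 < β) (hγ : 0 < γ) (hN : 1 ≤ N)
    (hT : 0 < T) {gN : PhaseSpace N → ℝ} (hgC : ContDiff ℝ 2 gN)
    (hgL2 : MemLp gN 2 ((pinnedChain ω₂ lam β γ).gibbsMeasure N T))
    (hgpde : ∀ y, (pinnedChain ω₂ lam β γ).generator N T T gN y = -(kin N 0 y - T)) :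
    ∫ y, partialP ⟨N - 1, by omega⟩ gN y ^ 2 ∂((pinnedChain ω₂ lam β γ).gibbsMeasure N T) ≤
      T / γ ^ 4 * plainKubo ω₂ lam β γ T N gN * (γ - plainKubo ω₂ lam β γ T N gN) := by
  have hdir := plainField_dirichlet hω hl hβ.le hγ hN hT hgC hgL2 hgpde
  have hsrc := plainField_sourceGradient_sq_ge hω hl hβ.le hγ hN hT hgC hgL2 hgpde
  set μ := (pinnedChain ω₂ lam β γ).gibbsMeasure N T with hμ
  set A := ∫ y, partialP ⟨0, by omega⟩ gN y ^ 2 ∂μ with hA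
  set B := ∫ y, partialP ⟨N - 1, by omega⟩ gN y ^ 2 ∂μ with hB
  set P0 := ∫ y, gN y * (kin N 0 y - T) ∂μ with hP0
  have eP0 : (∫ y, gN y * (ThermaliseThenCutProbeInsertion.kin N 0 y - T) ∂μ) = P0 := rfl
  rw [eP0] at hdir
  have hG : plainKubo ω₂ lam β γ T N gN = γ * (1 - γ / T ^ 2 * P0) := rfl
  rw [hG]
  have hγ0 : γ ≠ 0 := hγ.ne'
  have hT0 : T ≠ 0 := hT.ne'
  -- `B = P0/(γT) − A ≤ P0/(γT) − P0²/T³`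
  have hB' : B = P0 / (γ * T) - A := by
    field_simp
    linear_combination hdir
  have key : B ≤ P0 / (γ * T) - P0 ^ 2 / T ^ 3 := by rw [hB']; linarith
  have e : T / γ ^ 4 * (γ * (1 - γ / T ^ 2 * P0)) * (γ - γ * (1 - γ / T ^ 2 * P0)) = P0 / (γ * T) - P0 ^ 2 / T ^ 3 := by
    field_simp
    ring
  rw [e]
  exact key

/-- **`N`-UNIFORM BUDGET OF THE FLUCTUATING END GRADIENT.** Same setting: the part of the end gradient
orthogonal to `p_{N−1}` obeys `‖∂_{p_{N−1}} g_N − (G_N/γ²) p_{N−1}‖² ≤ (T/γ⁴) · G_N · (γ − 2 G_N)`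
(Pythagoras: the `p_{N−1}`-component is exactly `(G_N/γ²) p_{N−1}` by the far-end sum rule
`⟨g_N, p²_{N−1} − T⟩ = (T²/γ²) G_N`). -/
theorem plainField_fluctGradient_sq_le (hω : 0 < ω₂) (hl : 0 ≤ lam) (hβ : 0 < β) (hγ : 0 < γ) (hN : 1 ≤ N)
    (hT : 0 < T) {gN : PhaseSpace N → ℝ} (hgC : ContDiff ℝ 2 gN)
    (hgL2 : MemLp gN 2 ((pinnedChain ω₂ lam β γ).gibbsMeasure N T))
    (hgpde : ∀ y, (pinnedChain ω₂ lam β γ).generator N T T gN y = -(kin N 0 y - T)) :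
    ∫ y, (partialP ⟨N - 1, by omega⟩ gN y - plainKubo ω₂ lam β γ T N gN / γ ^ 2 * y.2 ⟨N - 1, by omega⟩) ^ 2
        ∂((pinnedChain ω₂ lam β γ).gibbsMeasure N T) ≤
      T / γ ^ 4 * plainKubo ω₂ lam β γ T N gN * (γ - 2 * plainKubo ω₂ lam β γ T N gN) := by
  have hend := plainField_endGradient_sq_le hω hl hβ hγ hN hT hgC hgL2 hgpde
  have hpair := plainField_endPairing hω hl hβ hγ hN hT hgC hgL2 hgpde
  have hproj := plainField_projection hω hl hβ.le hγ hN hT hgC hgL2 hgpde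
  have hdg := memLp_partialP_plainField' hω hl hβ.le hγ hN hT hgC hgL2 hgpde
  set μ := (pinnedChain ω₂ lam β γ).gibbsMeasure N T with hμ
  have hpy := integral_sub_proj_sq (γ := γ) hω hl hβ.le hT ⟨N - 1, by omega⟩ hdg (plainKubo ω₂ lam β γ T N gN / γ ^ 2)
  rw [← hμ] at hpy
  set B := ∫ y, partialP ⟨N - 1, by omega⟩ gN y ^ 2 ∂μ with hB
  set P0 := ∫ y, gN y * (kin N 0 y - T) ∂μ with hP0
  set P1 := ∫ y, gN y * (kin N (N - 1) y - T) ∂μ with hP1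
  have eP0 : (∫ y, gN y * (ThermaliseThenCutProbeInsertion.kin N 0 y - T) ∂μ) = P0 := rfl
  have eP1 : (∫ y, gN y * (ThermaliseThenCutProbeInsertion.kin N (N - 1) y - T) ∂μ) = P1 := rfl
  rw [eP0, eP1] at hpair
  rw [eP1] at hproj
  rw [hproj, hpair] at hpy
  have hG : plainKubo ω₂ lam β γ T N gN = γ * (1 - γ / T ^ 2 * P0) := rfl
  rw [hG] at hpy hend ⊢
  rw [hpy]
  have hγ0 : γ ≠ 0 := hγ.ne'
  have hT0 : T ≠ 0 := hT.ne'
  have e : B - 2 * (γ * (1 - γ / T ^ 2 * P0) / γ ^ 2) * (1 / T * (T ^ 2 / γ - P0)) +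
      (γ * (1 - γ / T ^ 2 * P0) / γ ^ 2) ^ 2 * T =
      B - T / γ ^ 4 * (γ * (1 - γ / T ^ 2 * P0)) ^ 2 := by
    field_simp
    ring
  rw [e]
  nlinarith [hend]

/-- **Corollary (`N`-uniform): `G_N ≤ γ/2`** — the two-terminal conductance of the bare chain never exceeds half
the bath coupling (two contact resistances `1/γ` in series), sharpening the landed `plainKubo_le` (`G_N ≤ γ`). -/
theorem plainKubo_le_half (hω : 0 < ω₂) (hl : 0 < lam) (hβ : 0 < β) (hγ : 0 < γ) (hT : 0 < T) (hN : 2 ≤ N)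
    {gN : PhaseSpace N → ℝ} (hgN : gN ∈ plainForwardFields ω₂ lam β γ T N) :
    plainKubo ω₂ lam β γ T N gN ≤ γ / 2 := by
  have hG : 0 < plainKubo ω₂ lam β γ T N gN :=
    Theorems.SuperadditiveResistance.KuboPlain.plainKubo_pos ω₂ lam β γ T hω hl hβ hγ hT N hN gN hgN
  obtain ⟨hgC, hgL2, -, hgpde⟩ := hgN
  have h := plainField_fluctGradient_sq_le hω hl.le hβ hγ (show 1 ≤ N by omega) hT hgC hgL2 hgpde
  have hnn : 0 ≤ ∫ y, (partialP ⟨N - 1, by omega⟩ gN y - plainKubo ω₂ lam β γ T N gN / γ ^ 2 * y.2 ⟨N - 1, by omega⟩) ^ 2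
      ∂((pinnedChain ω₂ lam β γ).gibbsMeasure N T) := integral_nonneg fun y => sq_nonneg _
  have h1 : 0 ≤ T / γ ^ 4 * plainKubo ω₂ lam β γ T N gN * (γ - 2 * plainKubo ω₂ lam β γ T N gN) := hnn.trans h
  have h2 : 0 < T / γ ^ 4 * plainKubo ω₂ lam β γ T N gN := by positivity
  have h3 : 0 ≤ γ - 2 * plainKubo ω₂ lam β γ T N gN := nonneg_of_mul_nonneg_right (by linarith [h1]) h2
  linarith


/-! ### The device side: the resolvent field's far dissipation and κ-mass are `O(K₀₀)` -/

/-- Sums against the device's thermostat weights pick out the four terminal sites `0, N+M−1, N−1, N`. -/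
theorem sum_deviceWeight_mul (hN : 1 ≤ N) (hM : 1 ≤ M) (F : Fin (N + M) → ℝ) :
    ∑ i, deviceWeight N M i * F i =
      F ⟨0, by omega⟩ + F ⟨N + M - 1, by omega⟩ + (F ⟨N - 1, by omega⟩ + F ⟨N, by omega⟩) := by
  have h1 := sum_bathWeight_mul (show 1 ≤ N + M by omega) F
  have e1 : ∀ i : Fin (N + M), (if i.val = N - 1 then F i else 0) = if i = ⟨N - 1, by omega⟩ then F i else 0 :=
    fun i => by
      by_cases hi : i = ⟨N - 1, by omega⟩
      · subst hi; simp
      · have : i.val ≠ N - 1 := fun h => hi (Fin.ext h)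
        simp [hi, this]
  have e2 : ∀ i : Fin (N + M), (if i.val = N then F i else 0) = if i = ⟨N, by omega⟩ then F i else 0 :=
    fun i => by
      by_cases hi : i = ⟨N, by omega⟩
      · subst hi; simp
      · have : i.val ≠ N := fun h => hi (Fin.ext h)
        simp [hi, this]
  have h2 : ∑ i : Fin (N + M), ((if i.val = N - 1 then (1 : ℝ) else 0) + (if i.val = N then 1 else 0)) * F i =
      F ⟨N - 1, by omega⟩ + F ⟨N, by omega⟩ := by
    simp only [add_mul, Finset.sum_add_distrib, ite_mul, one_mul, zero_mul, e1, e2, Finset.sum_ite_eq',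
      Finset.mem_univ, if_true]
  simp only [deviceWeight, add_mul, Finset.sum_add_distrib] at h1 h2 ⊢
  linarith

/-- The device's thermostat weight at the left bath site `0` is positive. -/
theorem deviceWeight_zero_pos (hN : 1 ≤ N) (hM : 1 ≤ M) : 0 < deviceWeight N M ⟨0, by omega⟩ := by
  unfold deviceWeight OscillatorChain.bathWeight
  simp only [if_true]
  split_ifs <;> norm_num

/-- **Dissipation identity of a `κ`-resolvent field (fixed `N`, `M`, `κ`; exact).** For a classical `κ`-resolvent
field `g_0` of bath `0` of the `(N, M)`-device (`N, M ≥ 1`):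
`κ ‖g_0‖² + γT (‖∂_{p_0}g_0‖² + ‖∂_{p_{N+M−1}}g_0‖² + ‖∂_{p_{N−1}}g_0‖² + ‖∂_{p_N}g_0‖²) = ⟨g_0, p_0² − T⟩`
(all in `L²(μ_T^{(N+M)})`; `Kubo.fluctuation_dissipation` for the resolvent pair). -/
theorem resolvent_dissipation (hω : 0 < ω₂) (hl : 0 ≤ lam) (hβ : 0 ≤ β) (hγ : 0 < γ) (hN : 1 ≤ N) (hM : 1 ≤ M)
    (hT : 0 < T) (κ : ℝ) {g₀ : PhaseSpace (N + M) → ℝ} (hg₀C : ContDiff ℝ 2 g₀)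
    (hg₀L : MemLp g₀ 2 ((pinnedChain ω₂ lam β γ).gibbsMeasure (N + M) T))
    (hpde₀ : ∀ x, κ * g₀ x - deviceGenerator (pinnedChain ω₂ lam β γ) N M (fun _ => T) g₀ x =
      kin (N + M) 0 x - T) :
    κ * (∫ x, g₀ x ^ 2 ∂((pinnedChain ω₂ lam β γ).gibbsMeasure (N + M) T)) +
        γ * T * ((∫ x, partialP ⟨0, by omega⟩ g₀ x ^ 2 ∂((pinnedChain ω₂ lam β γ).gibbsMeasure (N + M) T)) +
          (∫ x, partialP ⟨N + M - 1, by omega⟩ g₀ x ^ 2 ∂((pinnedChain ω₂ lam β γ).gibbsMeasure (N + M) T)) +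
          ((∫ x, partialP ⟨N - 1, by omega⟩ g₀ x ^ 2 ∂((pinnedChain ω₂ lam β γ).gibbsMeasure (N + M) T)) +
            ∫ x, partialP ⟨N, by omega⟩ g₀ x ^ 2 ∂((pinnedChain ω₂ lam β γ).gibbsMeasure (N + M) T))) =
      ∫ x, g₀ x * (kin (N + M) 0 x - T) ∂((pinnedChain ω₂ lam β γ).gibbsMeasure (N + M) T) := by
  set P := pinnedChain ω₂ lam β γ with hP
  set ρ := P.gibbsDensity (N + M) T with hρ
  have hpair : ∀ x, 1 * liouvilleOp P (N + M) g₀ x + γ * bathOp (N + M) (deviceWeight N M) T g₀ x =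
      -((kin (N + M) 0 x - T) - κ * g₀ x) := fun x => deviceResolvent_pair ω₂ lam β γ T κ hpde₀ x
  have hk0 : MemLp (fun x : PhaseSpace (N + M) => kin (N + M) 0 x - T) 2 (P.gibbsMeasure (N + M) T) :=
    memLp_kin_sub hω hl hβ γ (N + M) 0 hT
  have hk : MemLp (fun x : PhaseSpace (N + M) => (kin (N + M) 0 x - T) - κ * g₀ x) 2 (P.gibbsMeasure (N + M) T) :=
    hk0.sub (hg₀L.const_mul κ)
  have hFD := fluctuation_dissipation hω hl hβ (N + M) hT (deviceWeight N M) (deviceWeight_nonneg' N M) 1 hγ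
    hg₀C hg₀L hk hpair
  rw [sum_deviceWeight_mul hN hM] at hFD
  have hI1 : Integrable fun x => g₀ x * (kin (N + M) 0 x - T) * ρ x :=
    integrable_mul_mul_gibbsDensity hω hl hβ γ (N + M) hT hg₀L hk0
  have hI2 : Integrable fun x => g₀ x * g₀ x * ρ x :=
    integrable_mul_mul_gibbsDensity hω hl hβ γ (N + M) hT hg₀L hg₀L
  have hsplit : ∫ x, g₀ x * ((kin (N + M) 0 x - T) - κ * g₀ x) * ρ x =
      (∫ x, g₀ x * (kin (N + M) 0 x - T) * ρ x) - κ * ∫ x, g₀ x ^ 2 * ρ x := by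
    have e2 : ∫ x, g₀ x ^ 2 * ρ x = ∫ x, g₀ x * g₀ x * ρ x := integral_congr_ae (ae_of_all _ fun x => by ring)
    rw [e2, ← integral_const_mul, ← integral_sub hI1 (hI2.const_mul κ)]
    exact integral_congr_ae (ae_of_all _ fun x => by ring)
  rw [hsplit] at hFD
  rw [P.integral_gibbsMeasure, P.integral_gibbsMeasure, P.integral_gibbsMeasure, P.integral_gibbsMeasure,
    P.integral_gibbsMeasure, P.integral_gibbsMeasure]
  set Z := ∫ x, ρ x with hZ
  simp only [← hρ]
  have key : κ * (Z⁻¹ * ∫ x, g₀ x ^ 2 * ρ x) +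
      γ * T * (Z⁻¹ * (∫ x, partialP ⟨0, by omega⟩ g₀ x ^ 2 * ρ x) +
        Z⁻¹ * (∫ x, partialP ⟨N + M - 1, by omega⟩ g₀ x ^ 2 * ρ x) +
        (Z⁻¹ * (∫ x, partialP ⟨N - 1, by omega⟩ g₀ x ^ 2 * ρ x) + Z⁻¹ * (∫ x, partialP ⟨N, by omega⟩ g₀ x ^ 2 * ρ x))) =
      Z⁻¹ * ((∫ x, g₀ x * (kin (N + M) 0 x - T) * ρ x) - κ * ∫ x, g₀ x ^ 2 * ρ x) + κ * (Z⁻¹ * ∫ x, g₀ x ^ 2 * ρ x) := by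
    rw [hFD]; ring
  linear_combination key

/-- **`N`-UNIFORM FAR-DISSIPATION AND MASS BUDGET OF THE DEVICE FIELD.** For the pinned chain (`ω₂ > 0`,
`lam, β ≥ 0`, `γ, T > 0`, `N, M ≥ 1`), any `κ` and any family `g` whose bath-`0` member is a `κ`-resolvent field, with
`K₀₀ = kuboMatrix … g 0 0`:

  `κ ‖g_0‖² + γT (‖∂_{p_{N−1}} g_0‖² + ‖∂_{p_N} g_0‖² + ‖∂_{p_{N+M−1}} g_0‖²) ≤ (T²/γ³) · K₀₀ · (γ − K₀₀)`

(the dissipation identity minus the Cauchy–Schwarz bound `‖∂_{p_0} g_0‖² ≥ (T/γ⁴)(γ − K₀₀)²` at the source site).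
So the device field's entropy production at the probe `N−1`, at the three far terminals altogether, and its
`κ`-mass are all `O(K₀₀)`, uniformly in `N, M, κ` — the device-side counterpart of `plainField_endGradient_sq_le`. -/
theorem resolventFamily_farDissipation_le (hω : 0 < ω₂) (hl : 0 ≤ lam) (hβ : 0 ≤ β) (hγ : 0 < γ) (hN : 1 ≤ N)
    (hM : 1 ≤ M) (hT : 0 < T) (κ : ℝ) (g : Fin 4 → PhaseSpace (N + M) → ℝ)
    (hg₀ : g 0 ∈ deviceResolventFields ω₂ lam β γ T N M 0 κ) :
    κ * (∫ x, g 0 x ^ 2 ∂((pinnedChain ω₂ lam β γ).gibbsMeasure (N + M) T)) +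
        γ * T * ((∫ x, partialP ⟨N - 1, by omega⟩ (g 0) x ^ 2 ∂((pinnedChain ω₂ lam β γ).gibbsMeasure (N + M) T)) +
          (∫ x, partialP ⟨N, by omega⟩ (g 0) x ^ 2 ∂((pinnedChain ω₂ lam β γ).gibbsMeasure (N + M) T)) +
          ∫ x, partialP ⟨N + M - 1, by omega⟩ (g 0) x ^ 2 ∂((pinnedChain ω₂ lam β γ).gibbsMeasure (N + M) T)) ≤
      T ^ 2 / γ ^ 3 * kuboMatrix ω₂ lam β γ T N M g 0 0 * (γ - kuboMatrix ω₂ lam β γ T N M g 0 0) := by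
  obtain ⟨hg₀C, hg₀L, hpde₀⟩ := hg₀
  set P := pinnedChain ω₂ lam β γ with hP
  set μ := P.gibbsMeasure (N + M) T with hμ
  have hdis := resolvent_dissipation hω hl hβ hγ hN hM hT κ hg₀C hg₀L hpde₀
  -- `∂_{p_0} g_0 ∈ L²` and the Cauchy–Schwarz bound at the source site
  have hpair : ∀ x, 1 * liouvilleOp P (N + M) (g 0) x + γ * bathOp (N + M) (deviceWeight N M) T (g 0) x =
      -((kin (N + M) 0 x - T) - κ * g 0 x) := fun x => deviceResolvent_pair ω₂ lam β γ T κ hpde₀ x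
  have hk0 : MemLp (fun x : PhaseSpace (N + M) => kin (N + M) 0 x - T) 2 μ := memLp_kin_sub hω hl hβ γ (N + M) 0 hT
  have hk : MemLp (fun x : PhaseSpace (N + M) => (kin (N + M) 0 x - T) - κ * g 0 x) 2 μ := hk0.sub (hg₀L.const_mul κ)
  have hd0 : MemLp (partialP ⟨0, by omega⟩ (g 0)) 2 μ :=
    memLp_partialP hω hl hβ γ (N + M) hT _ (deviceWeight_nonneg' N M) 1 hγ hg₀C hg₀L hk hpair
      (deviceWeight_zero_pos hN hM)
  have hproj : ∫ y, y.2 ⟨0, by omega⟩ * partialP ⟨0, by omega⟩ (g 0) y ∂μ =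
      1 / T * ∫ y, g 0 y * (kin (N + M) 0 y - T) ∂μ := by
    have h := gauss_ibp hω hl hβ (N + M) hT ⟨0, by omega⟩ (hg₀C.of_le (by norm_cast)) hg₀L hd0
    rw [hμ, P.integral_gibbsMeasure, P.integral_gibbsMeasure]
    have e1 : ∫ x, g 0 x * (kin (N + M) 0 x - T) * P.gibbsDensity (N + M) T x =
        ∫ x, (x.2 ⟨0, by omega⟩ ^ 2 - T) * g 0 x * P.gibbsDensity (N + M) T x :=
      integral_congr_ae (ae_of_all _ fun x => by dsimp only; rw [kin_eq_sq (show 0 < N + M by omega)]; ring)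
    rw [e1, h]
    have hP' : pinnedChain ω₂ lam β γ = P := rfl
    simp only [hP']
    field_simp
  set A := ∫ y, partialP ⟨0, by omega⟩ (g 0) y ^ 2 ∂μ with hA
  set P0 := ∫ y, g 0 y * (kin (N + M) 0 y - T) ∂μ with hP0
  have hpy := integral_sub_proj_sq (γ := γ) hω hl hβ hT ⟨0, by omega⟩ hd0 (P0 / T ^ 2)
  rw [← hμ, hproj, ← hA] at hpy
  have hnn : 0 ≤ ∫ y, (partialP ⟨0, by omega⟩ (g 0) y - P0 / T ^ 2 * y.2 ⟨0, by omega⟩) ^ 2 ∂μ :=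
    integral_nonneg fun y => sq_nonneg _
  rw [hpy] at hnn
  have hT0 : T ≠ 0 := hT.ne'
  have hγ0 : γ ≠ 0 := hγ.ne'
  have e : A - 2 * (P0 / T ^ 2) * (1 / T * P0) + (P0 / T ^ 2) ^ 2 * T = A - P0 ^ 2 / T ^ 3 := by
    field_simp; ring
  rw [e] at hnn
  -- `P0 = (T²/γ²)(γ − K₀₀)`
  have hK : kuboMatrix ω₂ lam β γ T N M g 0 0 = γ - γ ^ 2 / T ^ 2 * P0 := kuboMatrix_zero_zero_eq ω₂ lam β γ T N M g
  rw [hK]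
  have e2 : T ^ 2 / γ ^ 3 * (γ - γ ^ 2 / T ^ 2 * P0) * (γ - (γ - γ ^ 2 / T ^ 2 * P0)) = P0 - γ * T * (P0 ^ 2 / T ^ 3) := by
    field_simp
    ring
  rw [e2]
  have hγT : 0 < γ * T := mul_pos hγ hT
  nlinarith [hdis, hnn, hγT]


/-- Registered helper sub-goal `helper_terminationEndGradientBudget` (the `N`-UNIFORM budgets of this file in stub form:
the bare field's end gradient and its fluctuating part are `O(√G_N)` in `L²(μ_T^{(N)})`, `G_N ≤ γ/2`, and the device
field's far dissipation and `κ`-mass are `O(K₀₀)`). -/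
theorem helper_terminationEndGradientBudget : ∀ (ω₂ lam β γ T : ℝ), 0 < ω₂ → 0 < lam → 0 < β → 0 < γ → 0 < T → ∀ (N M : ℕ) (hN : 2 ≤ N) (hM : 2 ≤ M) (κ : ℝ) (g : Fin 4 → PhaseSpace (N + M) → ℝ) (gN : PhaseSpace N → ℝ), (∀ a : Fin 4, g a ∈ deviceResolventFields ω₂ lam β γ T N M (termSite N M a) κ) → gN ∈ plainForwardFields ω₂ lam β γ T N → (∫ y, partialP ⟨N - 1, by omega⟩ gN y ^ 2 ∂((pinnedChain ω₂ lam β γ).gibbsMeasure N T)) ≤ T / γ ^ 4 * plainKubo ω₂ lam β γ T N gN * (γ - plainKubo ω₂ lam β γ T N gN) ∧ (∫ y, (partialP ⟨N - 1, by omega⟩ gN y - plainKubo ω₂ lam β γ T N gN / γ ^ 2 * y.2 ⟨N - 1, by omega⟩) ^ 2 ∂((pinnedChain ω₂ lam β γ).gibbsMeasure N T)) ≤ T / γ ^ 4 * plainKubo ω₂ lam β γ T N gN * (γ - 2 * plainKubo ω₂ lam β γ T N gN) ∧ plainKubo ω₂ lam β γ T N gN ≤ γ / 2 ∧ κ * (∫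 x, g 0 x ^ 2 ∂((pinnedChain ω₂ lam β γ).gibbsMeasure (N + M) T)) + γ * T * ((∫ x, partialP ⟨N - 1, by omega⟩ (g 0) x ^ 2 ∂((pinnedChain ω₂ lam β γ).gibbsMeasure (N + M) T)) + (∫ x, partialP ⟨N, by omega⟩ (g 0) x ^ 2 ∂((pinnedChain ω₂ lam β γ).gibbsMeasure (N + M) T)) + ∫ x, partialP ⟨N + M - 1, by omega⟩ (g 0) x ^ 2 ∂((pinnedChain ω₂ lam β γ).gibbsMeasure (N + M) T)) ≤ T ^ 2 / γ ^ 3 * kuboMatrix ω₂ lam β γ T N M g 0 0 * (γ - kuboMatrix ω₂ lam β γ T N M g 0 0) := by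
  intro ω₂ lam β γ T hω hl hβ hγ hT N M hN hM κ g gN hg hgN
  refine ⟨?_, ?_, plainKubo_le_half hω hl hβ hγ hT hN hgN, ?_⟩
  · exact plainField_endGradient_sq_le hω hl.le hβ hγ (by omega) hT hgN.1 hgN.2.1 hgN.2.2.2
  · exact plainField_fluctGradient_sq_le hω hl.le hβ hγ (by omega) hT hgN.1 hgN.2.1 hgN.2.2.2
  · exact resolventFamily_farDissipation_le hω hl.le hβ.le hγ (by omega) (by omega) hT κ g (hg 0)

end Budget

end Summit.AtomisticToContinuum.FouriersLaw.Cruxes.SuperadditiveResistance.FloatingProbeBypassLaplacian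

end
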